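import Summits.AtomisticToContinuum.Crystallization.Theorems.FreeSplittingCertificatesStrictSplittingRuleTorusModel552

/-!
# The joint (r6) sitewise LMI on the hcp torus 5×5×2, parity B — MODEL-LEVEL THEOREM (finite model of H12⋆)

Route `FreeSplittingCertificates`, crux `StrictSplittingRule` (stmt-AtomisticToContinuum-12560); unit b2b-freesplit-B (block 2b,
PART B, gen 1).  **VALUE = a kernel-accepted (computational lane) theorem about a FINITE model — NOT summit progress.**

`jointLMI552B : ∀ u, demand5 siteB5 u + margin552 · normSqG5 u ≤ supply5 siteB5 u + transfer5 siteB5 u + meanProj5 u` (+ zero-mean form),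
`margin552 = 17171/2²⁰`.  Certificate: `d ≥ 0` and the row inequalities of the residual of the rounded `LDLᵀ` factor, both by
`native_decide` (300-dimensional; ~2 min in the evaluator); symmetry of the residual is `gramResidual_symm_comm` (no computation);
assembled by `isGramCertDD_symm_of_rows` into the trusted predicate `PSD.IsGramCertDD`.  COMPUTATIONAL regime (`Lean.ofReduceBool`).
-/

namespace Summit.AtomisticToContinuum.Crystallization.Theorems.StrictSplittingRuleTorusLMI

open Literature.Computation.Certificates

/-- The pivots of the rounded factor are nonnegative (5×5×2, parity B).  COMPUTATIONAL (`native_decide`). -/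
theorem cert5B_d : ∀ k, 0 ≤ vecOfArray (dimG 4 5) fact5B.1 k := by
  native_decide

/-- Row inequalities of the residual `mat5B − Bᵀ·diag d·B` (5×5×2, parity B).  COMPUTATIONAL (`native_decide`). -/
theorem cert5B_rows : ∀ i, ∑ j ∈ Finset.univ.erase i,
    |PSD.gramResidual mat5B (vecOfArray (dimG 4 5) fact5B.1) (matrixOfArrays (dimG 4 5) (dimG 4 5) fact5B.2) i j| ≤
      PSD.gramResidual mat5B (vecOfArray (dimG 4 5) fact5B.1) (matrixOfArrays (dimG 4 5) (dimG 4 5) fact5B.2) i i := by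
  native_decide

/-- **Certificate, 5×5×2 parity B**: `mat5B ⪰ 0` (trusted predicate `PSD.IsGramCertDD`). -/
theorem cert5B_valid :
    PSD.IsGramCertDD mat5B (vecOfArray (dimG 4 5) fact5B.1) (matrixOfArrays (dimG 4 5) (dimG 4 5) fact5B.2) :=
  isGramCertDD_symm_of_rows cert5B_d cert5B_rows

/-- **The joint (r6) sitewise LMI at the B site of the 5×5×2 hcp torus, margin `m = 17171/2²⁰`**: for every displacement field `u`,
`D_p(u) + m‖u‖²_G ≤ S_p(u) + T_p(u) + meanProj(u)`.  Finite model of H12⋆, not the stub. -/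
theorem jointLMI552B (u : Fin (dimG 4 5) → ℚ) :
    demand5 siteB5 u + margin552 * normSqG5 u ≤ supply5 siteB5 u + transfer5 siteB5 u + meanProj5 u := by
  have h := evalQ_nonneg_of_certDD (ts := certTermsG 4 5 siteB5 1 margin552 tableClasses552) rfl cert5B_valid u
  rw [evalQ_certTermsG_552] at h
  linarith

/-- **Zero-mean form, 5×5×2 B site.** -/
theorem jointLMI552B_zeroMean (u : Fin (dimG 4 5) → ℚ) (h0 : ∀ c : Fin 3, (sumFG 4 5 c).eval u = 0) :
    demand5 siteB5 u + margin552 * normSqG5 u ≤ supply5 siteB5 u + transfer5 siteB5 u := by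
  have h := jointLMI552B u
  rw [meanProj5_eq_zero h0, add_zero] at h
  exact h

end Summit.AtomisticToContinuum.Crystallization.Theorems.StrictSplittingRuleTorusLMI
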